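import Mathlib.RingTheory.Ideal.GoingUp
import Mathlib.RingTheory.LocalRing.ResidueField.Basic
import Mathlib.RingTheory.TensorProduct.Finite
import HarnessLib

/-!
# Tensor products of finite local algebras with trivial residue extension are local
# ([Tate1997FiniteFlatGroupSchemes] (3.7) Lemma 2); [StacksProject] Tag 04GG)

Topic `Literature/RingTheory/Henselian`; namespace `Literature.RingTheory.Henselian`.  PROOF FILE (theorems only; no
definition, no named fact, no instance, no notation, no `sorry`).  Cell `hodgecm-mathlib` (D-0151), FLOOR-0 P5a row G3
(generic input of «the unit component `G⁰` of a finite group scheme over a henselian local ring is a subgroup»: Tate's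
Lemma 2) in (3.7), «`T_i ×_S T_j` is connected iff `k_i` or `k_j` is purely inseparable over `k`», in the special case
`k_i = k` that the unit component needs).  Companion of ★ `Henselian/FiniteAlgebraProductOfLocalizations` (the product
decomposition); no henselian hypothesis is needed HERE.

For a commutative ring `R` and module-finite commutative `R`-algebras `A, A'` with `A, A'` LOCAL:
* `map_maximalIdeal_le_of_isMaximal` — every maximal ideal of `A ⊗[R] A'` contains `𝔪_A ⊗ 1` and `1 ⊗ 𝔪_{A'}`
  (integrality of `A ⊗ A'`, `A`, `A'` over `R`: a prime of `A` over the maximal contraction is maximal);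
* `surjective_mk_comp_includeRight` — if the residue field of `A` is generated by `R` (every `a ≡ r·1 (mod 𝔪_A)`), then
  `A' → (A ⊗[R] A') ⧸ K` is surjective for any ideal `K ⊇ 𝔪_A ⊗ 1`;
* **`isLocalRing_tensorProduct`** — under the same hypothesis, a non-trivial `A ⊗[R] A'` is a LOCAL ring (unique
  maximal ideal `𝔪_A ⊗ 1 + 1 ⊗ 𝔪_{A'}`).

HC_CM is proved only modulo the 7 printed citations until rung 0 closes; this file is generic commutative algebra and
changes no count.

## References
* [Tate1997FiniteFlatGroupSchemes] J. Tate, *Finite flat group schemes*, in: Cornell–Silverman–Stevens (eds.), *Modular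
  Forms and Fermat's Last Theorem* (Springer 1997), (3.7), Lemma 2) of the proof of (I).
* [StacksProject] The Stacks Project, Tag 04GG (Algebra, Lemma 10.153.3).
-/

set_option autoImplicit false

noncomputable section

universe u v w

open IsLocalRing TensorProduct

namespace Literature.RingTheory.Henselian

section TensorLocal

variable {R : Type u} [CommRing R]
variable {A : Type v} [CommRing A] [Algebra R A] [IsLocalRing A] [Module.Finite R A]
variable {A' : Type w} [CommRing A'] [Algebra R A'] [IsLocalRing A'] [Module.Finite R A']

/-- Over a local ring `R`, a maximal ideal of `A ⊗[R] A'` (`A, A'` module-finite) contains `𝔪_A ⊗ 1` and `1 ⊗ 𝔪_{A'}`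
when `A, A'` are local. [cite: StacksProject, Tag 04GG] -/
theorem map_maximalIdeal_le_of_isMaximal (𝔐 : Ideal (A ⊗[R] A')) [h𝔐 : 𝔐.IsMaximal] :
    (maximalIdeal A).map (Algebra.TensorProduct.includeLeft : A →ₐ[R] A ⊗[R] A') ≤ 𝔐 ∧
      (maximalIdeal A').map (Algebra.TensorProduct.includeRight : A' →ₐ[R] A ⊗[R] A') ≤ 𝔐 := by
  haveI : Algebra.IsIntegral R (A ⊗[R] A') := Algebra.IsIntegral.of_finite R _
  haveI : Algebra.IsIntegral R A := Algebra.IsIntegral.of_finite R A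
  haveI : Algebra.IsIntegral R A' := Algebra.IsIntegral.of_finite R A'
  have hR : (𝔐.comap (algebraMap R (A ⊗[R] A'))).IsMaximal := Ideal.isMaximal_comap_of_isIntegral_of_isMaximal 𝔐
  constructor
  · haveI : (𝔐.comap (Algebra.TensorProduct.includeLeft : A →ₐ[R] A ⊗[R] A')).IsPrime := Ideal.comap_isPrime _ _
    have hPc : ((𝔐.comap (Algebra.TensorProduct.includeLeft : A →ₐ[R] A ⊗[R] A')).comap (algebraMap R A)).IsMaximal := by
      have h : (𝔐.comap (Algebra.TensorProduct.includeLeft : A →ₐ[R] A ⊗[R] A')).comap (algebraMap R A) =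
          𝔐.comap (algebraMap R (A ⊗[R] A')) := by
        ext x; simp only [Ideal.mem_comap, AlgHom.commutes]
      rw [h]; exact hR
    have hPm := Ideal.isMaximal_of_isIntegral_of_isMaximal_comap _ hPc
    rw [Ideal.map_le_iff_le_comap, ← IsLocalRing.eq_maximalIdeal hPm]
  · haveI : (𝔐.comap (Algebra.TensorProduct.includeRight : A' →ₐ[R] A ⊗[R] A')).IsPrime := Ideal.comap_isPrime _ _
    have hPc : ((𝔐.comap (Algebra.TensorProduct.includeRight : A' →ₐ[R] A ⊗[R] A')).comap (algebraMap R A')).IsMaximal := by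
      have h : (𝔐.comap (Algebra.TensorProduct.includeRight : A' →ₐ[R] A ⊗[R] A')).comap (algebraMap R A') =
          𝔐.comap (algebraMap R (A ⊗[R] A')) := by
        ext x; simp only [Ideal.mem_comap, AlgHom.commutes]
      rw [h]; exact hR
    have hPm := Ideal.isMaximal_of_isIntegral_of_isMaximal_comap _ hPc
    rw [Ideal.map_le_iff_le_comap, ← IsLocalRing.eq_maximalIdeal hPm]

omit [IsLocalRing A'] [Module.Finite R A] [Module.Finite R A'] in
/-- If the residue field of the local `R`-algebra `A` is generated by `R` (every `a ∈ A` is `≡ r·1 (mod 𝔪_A)` for some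
`r ∈ R`), then `A' → (A ⊗[R] A') ⧸ (𝔪_A ⊗ 1 + 1 ⊗ 𝔪_{A'})` is surjective. [cite: StacksProject, Tag 04GG] -/
theorem surjective_mk_comp_includeRight (hA : ∀ a : A, ∃ r : R, a - algebraMap R A r ∈ maximalIdeal A)
    (K : Ideal (A ⊗[R] A'))
    (hK : (maximalIdeal A).map (Algebra.TensorProduct.includeLeft : A →ₐ[R] A ⊗[R] A') ≤ K) :
    Function.Surjective ((Ideal.Quotient.mk K).comp
      (Algebra.TensorProduct.includeRight : A' →ₐ[R] A ⊗[R] A').toRingHom) := by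
  intro x
  obtain ⟨x, rfl⟩ := Ideal.Quotient.mk_surjective x
  induction x using TensorProduct.induction_on with
  | zero => exact ⟨0, by simp⟩
  | tmul a a' =>
      obtain ⟨r, hr⟩ := hA a
      refine ⟨r • a', ?_⟩
      rw [RingHom.comp_apply, Ideal.Quotient.eq]
      have : a ⊗ₜ[R] a' - (1 : A) ⊗ₜ[R] (r • a') = (a - algebraMap R A r) ⊗ₜ[R] a' := by
        rw [TensorProduct.sub_tmul, Algebra.algebraMap_eq_smul_one, TensorProduct.smul_tmul]
      change (Algebra.TensorProduct.includeRight : A' →ₐ[R] A ⊗[R] A') (r • a') - a ⊗ₜ[R] a' ∈ K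
      rw [Algebra.TensorProduct.includeRight_apply, ← neg_sub, this]
      refine K.neg_mem (hK ?_)
      have hmem : (a - algebraMap R A r) ⊗ₜ[R] a' =
          (Algebra.TensorProduct.includeLeft : A →ₐ[R] A ⊗[R] A') (a - algebraMap R A r) * (1 ⊗ₜ[R] a') := by
        rw [Algebra.TensorProduct.includeLeft_apply, Algebra.TensorProduct.tmul_mul_tmul, mul_one, one_mul]
      rw [hmem]
      exact Ideal.mul_mem_right _ _ (Ideal.mem_map_of_mem _ hr)
  | add x y hx hy =>
      obtain ⟨s, hs⟩ := hx
      obtain ⟨t, ht⟩ := hy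
      exact ⟨s + t, by rw [map_add, hs, ht, map_add]⟩

/-- **Tensor products of finite local algebras with trivial residue extension are local.** Let `R` be local and `A, A'`
module-finite local `R`-algebras such that the residue field of `A` is generated by `R`; if `A ⊗[R] A'` is non-trivial
it is a LOCAL ring (its unique maximal ideal is `𝔪_A ⊗ 1 + 1 ⊗ 𝔪_{A'}`).  This is the algebra behind «`G⁰ × G⁰` is
connected» for the unit component of a finite flat group scheme over a henselian local base.
[cite: Tate1997FiniteFlatGroupSchemes, (3.7) Lemma 2)] [cite: StacksProject, Tag 04GG] -/
theorem isLocalRing_tensorProduct [Nontrivial (A ⊗[R] A')]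
    (hA : ∀ a : A, ∃ r : R, a - algebraMap R A r ∈ maximalIdeal A) : IsLocalRing (A ⊗[R] A') := by
  classical
  set K : Ideal (A ⊗[R] A') :=
    (maximalIdeal A).map (Algebra.TensorProduct.includeLeft : A →ₐ[R] A ⊗[R] A') ⊔
      (maximalIdeal A').map (Algebra.TensorProduct.includeRight : A' →ₐ[R] A ⊗[R] A') with hKdef
  have hKle : ∀ 𝔐 : Ideal (A ⊗[R] A'), 𝔐.IsMaximal → K ≤ 𝔐 := fun 𝔐 h𝔐 => by
    haveI := h𝔐
    obtain ⟨h₁, h₂⟩ := map_maximalIdeal_le_of_isMaximal (R := R) (A := A) (A' := A') 𝔐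
    exact sup_le h₁ h₂
  -- `K ≠ ⊤` since the ring is non-trivial
  obtain ⟨𝔐₀, h𝔐₀⟩ := Ideal.exists_maximal (A ⊗[R] A')
  have hKtop : K ≠ ⊤ := fun h => h𝔐₀.ne_top (top_le_iff.1 (h ▸ hKle 𝔐₀ h𝔐₀))
  -- the quotient by `K` is a quotient of the local ring `A'`, hence local
  have hsurj := surjective_mk_comp_includeRight (R := R) (A := A) (A' := A') hA K le_sup_left
  haveI : Nontrivial ((A ⊗[R] A') ⧸ K) := Ideal.Quotient.nontrivial_iff.2 hKtop
  haveI : IsLocalRing ((A ⊗[R] A') ⧸ K) := IsLocalRing.of_surjective' _ hsurj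
  refine IsLocalRing.of_unique_max_ideal ⟨𝔐₀, h𝔐₀, fun 𝔐 h𝔐 => ?_⟩
  -- two maximal ideals containing `K` agree modulo `K`
  have key : ∀ 𝔐 : Ideal (A ⊗[R] A'), 𝔐.IsMaximal →
      𝔐 = (maximalIdeal ((A ⊗[R] A') ⧸ K)).comap (Ideal.Quotient.mk K) := fun 𝔐 h𝔐 => by
    have hle := hKle 𝔐 h𝔐
    have hcm : (𝔐.map (Ideal.Quotient.mk K)).comap (Ideal.Quotient.mk K) = 𝔐 := by
      rw [Ideal.comap_map_of_surjective _ Ideal.Quotient.mk_surjective, ← RingHom.ker_eq_comap_bot, Ideal.mk_ker,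
        sup_eq_left.2 hle]
    have hmax : (𝔐.map (Ideal.Quotient.mk K)).IsMaximal := by
      refine (Ideal.map_eq_top_or_isMaximal_of_surjective _ Ideal.Quotient.mk_surjective h𝔐).resolve_left fun htop =>
        h𝔐.ne_top ?_
      rw [← hcm, htop, Ideal.comap_top]
    rw [← IsLocalRing.eq_maximalIdeal hmax, hcm]
  rw [key 𝔐 h𝔐, key 𝔐₀ h𝔐₀]

end TensorLocal


end Literature.RingTheory.Henselian

end
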